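import Mathlib
import Summits.PneNP.PneNP.Theorems.ClusUniversalCertificateCoordSliceZeroFree

/-!
# Route ClusUniversalCertificate, crux `UniversalCertAll` — path `coord`: the block step along a size-1 block with NESTED slices

Support file for `stmt-PneNP-19683` (cell pnp-ideate, route `ClusUniversalCertificate`, rung F-N1; path `coord` of pnp-ideate-p1, skeleton v13
sha16 c4824afb; ask «T1-nested» of p1 g7, ROUND-7 §6b/§6c; objects of record `…CoordDefs.lean` p516754 / `…CoordBlkDefs.lean` p519312 /
`…CoordGauge.lean` p524008, namespace `…Theorems.ClusCoord`).

**Theorem (`peelBlock_slices_of_nested`).**  Let block `k` consist of the single coordinate `i` and suppose the two slices of `Y` along `i` are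
NESTED: for some level `a`, every `y ∈ Y` with `y i = a` has `y + e_i ∈ Y`.  Then the slices (= the thresholds) of block `k` satisfy the block
layer inequality, i.e. the block disjunct of the peel conjecture holds for `(Y, k)`.
Proof (via the landed gauge bound `ClusCoordGauge.peelBlock_slices_of_twisted_le`, `H = 0`, where the allowance `bsize k − 1` vanishes): it
suffices that at most `2·Z_k(Y)` points are `0`-twisted.  KEY LEMMA (`exists_blockVec_of_twisted_of_dominates`, any block size): if the slice of
`y` DOMINATES (`∀ w ∈ Y, w − π_k w + π_k y ∈ Y`) and `y` is `0`-twisted, then some nonzero block-`k`-supported `v` has `y + v ∈ Y` — flatten an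
optimal flat `Φ ∋ y` into the slice of `y` (`mk' y (Φ.direction.map (id − π_k)) ⊆ Y` by domination); were `id − π_k` injective on the direction, the
flattened flat would be optimal with zero block-`k` rank, contradicting twistedness; so the direction contains a nonzero vector killed by `id − π_k`,
i.e. supported on block `k`.  For a size-1 block that vector is `e_i`; the dominating level is `1 − a`, so its twisted points inject into level `a`
by `+ e_i`, and level `a` has at most `Z_k(Y)` points (for `a = 1` inject once more).  Hence `#twisted ≤ 2 Z_k = 2^{bsize k} Z_k`.
FRONTIER rung F-N1; a special case of p1's conjecture T1 — the conjecture and the crux are OPEN; nothing here bears on P vs NP.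
-/

set_option linter.dupNamespace false -- `Summit.PneNP.PneNP.…`: summit = sub-problem name (D-0017 single-conjunct layout)

namespace Summit.PneNP.PneNP.Theorems.ClusCoordNested

open Finset
open Summit.PneNP.PneNP.Theorems.ClusCoord (acodim bsize zcount kemb IsBLayerFamily BLayerIneq)
open Summit.PneNP.PneNP.Theorems.ClusCoordZeroFree (blockProj blockProj_apply blockProj_eq_zero_iff blockProj_blockProj_self)
open Summit.PneNP.PneNP.Theorems.ClusCoordGauge (gaugeMap Twisted exists_optimal peelBlock_slices_of_twisted_le)
open Summit.PneNP.PneNP.Theorems.ClusCoordSliceZeroFree (gaugeMap_zero)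

variable {M M' n : ℕ}

/-! ## The key lemma: a twisted point in a dominating slice has a fibre neighbour -/

/-- **Key lemma** (any block size): if the slice of `y` dominates (`w − π_k w + π_k y ∈ Y` for all `w ∈ Y`) and `y` is `0`-twisted, then
`y + v ∈ Y` for some nonzero vector `v` supported on block `k`. -/
theorem exists_blockVec_of_twisted_of_dominates (blk : Fin M → Fin n) (Y : Finset (Fin M → ZMod 2)) (k : Fin n)
    (h : (univ.filter fun i => blk i ≠ k).card = M') (hk : 0 < bsize blk k) (y : Fin M → ZMod 2) (hy : y ∈ Y)
    (hdom : ∀ w ∈ Y, w - blockProj blk k w + blockProj blk k y ∈ Y) (ht : Twisted blk Y k M' h 0 y) :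
    ∃ v : Fin M → ZMod 2, v ≠ 0 ∧ blockProj blk k v = v ∧ y + v ∈ Y := by
  obtain ⟨A, hyA, hAY, hopt⟩ := exists_optimal Y y hy
  set D := A.direction with hD
  -- the horizontal projection `p = id − π_k` and the flattened flat `y + p(D)`
  set p : (Fin M → ZMod 2) →ₗ[ZMod 2] (Fin M → ZMod 2) := LinearMap.id - blockProj blk k with hp
  have hp_apply : ∀ v, p v = v - blockProj blk k v := fun v => rfl
  have hflat : ∀ w ∈ (AffineSubspace.mk' y (D.map p) : AffineSubspace (ZMod 2) (Fin M → ZMod 2)), w ∈ Y := by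
    intro w hw
    rw [AffineSubspace.mem_mk', Submodule.mem_map] at hw
    obtain ⟨d, hd, hdw⟩ := hw
    have hzA : d +ᵥ y ∈ A := AffineSubspace.vadd_mem_of_mem_direction hd hyA
    have := hdom _ (hAY _ hzA)
    have hw' : w = (d +ᵥ y) - blockProj blk k (d +ᵥ y) + blockProj blk k y := by
      rw [vadd_eq_add, map_add]
      have : p d = w -ᵥ y := hdw
      rw [hp_apply, vsub_eq_sub] at this
      -- `w = p d + y`
      have hw2 : w = d - blockProj blk k d + y := by rw [← sub_eq_iff_eq_add.mp this.symm]
      rw [hw2]; abel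
    rw [hw']
    exact this
  -- if `p` were injective on `D`, the flattened flat would be optimal with zero block-`k` rank
  by_contra hcon
  push Not at hcon
  have hinj : ∀ d ∈ D, p d = 0 → d = 0 := by
    intro d hd hpd
    by_contra hne
    -- `d` is supported on block `k` and `y + d ∈ Y`
    have hsupp : blockProj blk k d = d := by
      have : d - blockProj blk k d = 0 := hpd
      rw [sub_eq_zero] at this
      exact this.symm
    have hyd : y + d ∈ Y := by
      have := hAY _ (AffineSubspace.vadd_mem_of_mem_direction hd hyA)
      rw [vadd_eq_add, add_comm] at this
      exact this
    exact hcon d hne hsupp hyd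
  have hker : LinearMap.ker (p.domRestrict D) = ⊥ := by
    rw [LinearMap.ker_eq_bot']
    intro d hd
    exact Subtype.ext (hinj d d.2 hd)
  have hdim : Module.finrank (ZMod 2) (D.map p) = Module.finrank (ZMod 2) D := by
    have := LinearMap.finrank_range_add_finrank_ker (p.domRestrict D)
    rw [LinearMap.range_domRestrict, hker, finrank_bot, add_zero] at this
    exact this
  -- so the flattened flat is optimal, and twistedness gives full block-`k` rank of `p(D)` — which is zero
  have hopt' : M ≤ Module.finrank (ZMod 2) (AffineSubspace.mk' y (D.map p) : AffineSubspace (ZMod 2) (Fin M → ZMod 2)).direction +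
      acodim M Y y := by
    rw [AffineSubspace.direction_mk', hdim]; exact hopt
  have hfull := ht _ (AffineSubspace.self_mem_mk' _ _) hflat hopt'
  rw [gaugeMap_zero, AffineSubspace.direction_mk'] at hfull
  have hzero : (D.map p).map (blockProj blk k) = ⊥ := by
    rw [Submodule.eq_bot_iff]
    rintro w ⟨v, ⟨d, -, rfl⟩, rfl⟩
    rw [hp_apply, map_sub, blockProj_blockProj_self, sub_self]
  rw [hzero, finrank_bot] at hfull
  omega

/-! ## Size-1 blocks -/

/-- In a block of size `1` consisting of the coordinate `i`, every coordinate of the block is `i`. -/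
theorem eq_of_bsize_one (blk : Fin M → Fin n) (k : Fin n) (hb : bsize blk k = 1) (i : Fin M) (hi : blk i = k) (i' : Fin M)
    (hi' : blk i' = k) : i' = i := by
  unfold bsize at hb
  obtain ⟨i₀, hi₀⟩ := Finset.card_eq_one.mp hb
  have h1 : i ∈ ({i₀} : Finset (Fin M)) := by rw [← hi₀]; simp [hi]
  have h2 : i' ∈ ({i₀} : Finset (Fin M)) := by rw [← hi₀]; simp [hi']
  rw [Finset.mem_singleton] at h1 h2
  rw [h1, h2]

/-- A nonzero vector supported on a size-1 block `{i}` is `e_i`. -/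
theorem eq_single_of_blockVec (blk : Fin M → Fin n) (k : Fin n) (hb : bsize blk k = 1) (i : Fin M) (hi : blk i = k)
    (v : Fin M → ZMod 2) (hv : v ≠ 0) (hsupp : blockProj blk k v = v) : v = Pi.single i 1 := by
  have h01 : ∀ c : ZMod 2, c ≠ 0 → c = 1 := by decide
  have hvi : v i = 1 := by
    apply h01
    intro hvi
    apply hv
    funext j
    by_cases hj : blk j = k
    · rw [eq_of_bsize_one blk k hb i hi j hj]; exact hvi
    · have := congrFun hsupp j
      rw [blockProj_apply, if_neg hj] at this
      exact this.symm
  funext j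
  by_cases hji : j = i
  · subst hji; rw [Pi.single_eq_same]; exact hvi
  · rw [Pi.single_eq_of_ne hji]
    have hj : blk j ≠ k := fun hj => hji (eq_of_bsize_one blk k hb i hi j hj)
    have := congrFun hsupp j
    rw [blockProj_apply, if_neg hj] at this
    exact this.symm

/-- For a size-1 block `{i}`: `π_k w` depends only on `w i`; `w − π_k w + π_k y` is `w` with coordinate `i` replaced by `y i`. -/
theorem sub_blockProj_add_apply (blk : Fin M → Fin n) (k : Fin n) (hb : bsize blk k = 1) (i : Fin M) (hi : blk i = k)
    (w y : Fin M → ZMod 2) (j : Fin M) :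
    (w - blockProj blk k w + blockProj blk k y) j = if j = i then y i else w j := by
  simp only [Pi.add_apply, Pi.sub_apply, blockProj_apply]
  by_cases hji : j = i
  · subst hji; simp [hi]
  · have hj : blk j ≠ k := fun hj => hji (eq_of_bsize_one blk k hb i hi j hj)
    simp [hj, hji]

/-- For a size-1 block `{i}`: block `k` of `y` vanishes iff `y i = 0`. -/
theorem blockZero_iff_apply (blk : Fin M → Fin n) (k : Fin n) (hb : bsize blk k = 1) (i : Fin M) (hi : blk i = k)
    (y : Fin M → ZMod 2) : (∀ j, blk j = k → y j = 0) ↔ y i = 0 :=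
  ⟨fun hz => hz i hi, fun hy j hj => by rw [eq_of_bsize_one blk k hb i hi j hj]; exact hy⟩

/-! ## The nested case -/

open scoped Classical in
/-- **The block step along a size-1 block with NESTED slices** (p1's T1-nested): if every point of level `a` of coordinate `i` stays in `Y`
when coordinate `i` is flipped, the slices of the block `{i}` satisfy the block layer inequality. -/
theorem peelBlock_slices_of_nested (blk : Fin M → Fin n) (Y : Finset (Fin M → ZMod 2)) (k : Fin n) (M' : ℕ)
    (h : (univ.filter fun i => blk i ≠ k).card = M') (i : Fin M) (hi : blk i = k) (hb : bsize blk k = 1) (a : ZMod 2)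
    (hnest : ∀ y ∈ Y, y i = a → y + Pi.single i 1 ∈ Y) :
    ∃ L : List (Finset (Fin M' → ZMod 2)), IsBLayerFamily blk Y k M' h L ∧ BLayerIneq M n blk Y k M' L := by
  apply peelBlock_slices_of_twisted_le blk Y k M' h
  have h01 : ∀ c : ZMod 2, c = 0 ∨ c = 1 := by decide
  have hflip : ∀ c : ZMod 2, c ≠ a → c + 1 = a := by
    intro c hc
    rcases h01 c with rfl | rfl <;> rcases h01 a with rfl | rfl <;> first | exact absurd rfl hc | decide
  -- level `a` and the twisted points of the other level
  set La := Y.filter fun y => y i = a with hLa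
  set Tw := Y.filter (Twisted blk Y k M' h 0) with hTw
  -- (1) a twisted point off level `a` moves into level `a` by `+ e_i`
  have hmove : ∀ y ∈ Tw, y i ≠ a → y + Pi.single i 1 ∈ La := by
    intro y hy hya
    obtain ⟨hyY, hyt⟩ := Finset.mem_filter.1 hy
    -- the slice of `y` dominates
    have hdom : ∀ w ∈ Y, w - blockProj blk k w + blockProj blk k y ∈ Y := by
      intro w hw
      by_cases hwi : w i = y i
      · have : w - blockProj blk k w + blockProj blk k y = w := by
          funext j
          rw [sub_blockProj_add_apply blk k hb i hi]
          split_ifs with hji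
          · rw [hji, hwi]
          · rfl
        rw [this]; exact hw
      · -- then `w i = a` and the flipped point is `w + e_i`
        have hwa : w i = a := by
          rcases h01 (w i) with h0 | h0 <;> rcases h01 (y i) with h1 | h1 <;> rcases h01 a with h2 | h2 <;>
            simp_all
        have : w - blockProj blk k w + blockProj blk k y = w + Pi.single i 1 := by
          funext j
          rw [sub_blockProj_add_apply blk k hb i hi, Pi.add_apply]
          split_ifs with hji
          · rw [hji, Pi.single_eq_same, hwa]
            have := hflip (y i) hya
            rcases h01 (y i) with h0 | h0 <;> rcases h01 a with h2 | h2 <;> simp_all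
          · rw [Pi.single_eq_of_ne hji, add_zero]
        rw [this]
        exact hnest w hw hwa
    obtain ⟨v, hv0, hvs, hyv⟩ := exists_blockVec_of_twisted_of_dominates blk Y k h (by omega) y hyY hdom hyt
    rw [eq_single_of_blockVec blk k hb i hi v hv0 hvs] at hyv
    refine Finset.mem_filter.2 ⟨hyv, ?_⟩
    rw [Pi.add_apply, Pi.single_eq_same]
    exact hflip _ hya
  -- (2) counting: `#Tw ≤ #La + #La`
  have hsplit : Tw.card ≤ La.card + (Tw.filter fun y => y i ≠ a).card := by
    calc Tw.card = (Tw.filter fun y => y i = a).card + (Tw.filter fun y => ¬ y i = a).card :=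
          (Finset.card_filter_add_card_filter_not _).symm
      _ ≤ La.card + (Tw.filter fun y => y i ≠ a).card := by
          apply Nat.add_le_add_right
          apply Finset.card_le_card
          intro y hy
          obtain ⟨hy1, hy2⟩ := Finset.mem_filter.1 hy
          exact Finset.mem_filter.2 ⟨(Finset.mem_filter.1 hy1).1, hy2⟩
  have hinj : (Tw.filter fun y => y i ≠ a).card ≤ La.card := by
    have : ((Tw.filter fun y => y i ≠ a).image fun y => y + Pi.single i 1) ⊆ La := by
      intro z hz
      obtain ⟨y, hy, rfl⟩ := Finset.mem_image.1 hz
      obtain ⟨hyT, hya⟩ := Finset.mem_filter.1 hy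
      exact hmove y hyT hya
    calc (Tw.filter fun y => y i ≠ a).card = ((Tw.filter fun y => y i ≠ a).image fun y => y + Pi.single i 1).card :=
          (Finset.card_image_of_injective _ (add_left_injective _)).symm
      _ ≤ La.card := Finset.card_le_card this
  -- (3) `#La ≤ Z_k(Y)` (level `a` injects into level `0` by `+ e_i` when `a = 1`)
  have hLa_le : La.card ≤ zcount blk k Y := by
    unfold zcount
    rw [Finset.filter_congr fun y (_ : y ∈ Y) => blockZero_iff_apply blk k hb i hi y]
    rcases h01 a with ha | ha
    · rw [hLa, ha]
    · have hsub : (La.image fun y => y + Pi.single i 1) ⊆ Y.filter fun y => y i = 0 := by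
        intro z hz
        obtain ⟨y, hy, rfl⟩ := Finset.mem_image.1 hz
        obtain ⟨hyY, hya⟩ := Finset.mem_filter.1 hy
        refine Finset.mem_filter.2 ⟨hnest y hyY hya, ?_⟩
        rw [Pi.add_apply, Pi.single_eq_same, hya, ha]
        decide
      calc La.card = (La.image fun y => y + Pi.single i 1).card :=
            (Finset.card_image_of_injective _ (add_left_injective _)).symm
        _ ≤ (Y.filter fun y => y i = 0).card := Finset.card_le_card hsub
  have hpow : (2 : ℤ) ^ bsize blk k = 2 := by rw [hb]; norm_num
  rw [hpow]
  have : (Tw.card : ℤ) ≤ 2 * (zcount blk k Y : ℤ) := by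
    have h1 : Tw.card ≤ 2 * zcount blk k Y := by omega
    exact_mod_cast h1
  exact this

end Summit.PneNP.PneNP.Theorems.ClusCoordNested
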